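import Literature.NumberTheory.Automorphic.GaloisActionPlaces
import Mathlib.RingTheory.Coprime.Lemmas
import Mathlib.RingTheory.DedekindDomain.Ideal.Lemmas
import HarnessLib

/-!
# The product of a set of Galois conjugates of a prime: its shape at the prime and at a «conjugate» prime

Topic `NumberTheory/NumberFields`; namespace `Literature.NumberTheory.NumberFields`.  Theorems only (no definition, no instance, no notation,
no named fact, no `sorry`).  Cell `hodgecm-mathlib` (D-0151), P6 «MOD programme» (crux hLiu418, `--supports`), sub-desk P6a, organ (C2-arith)
«FROBENIUS SHAPE OF THE TWIST IDEAL» (desk F0P6a-plan (g1) Defs v0.4c field `frob₀_twist`; A-p03 (g29)), FILE A: the Dedekind ∕ group-action half,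
in the generality of ★ `Automorphic/GaloisActionPlaces` §1 (a group `G` acting by ring automorphisms on a Dedekind domain `B`, hence on its non-zero
primes `HeightOneSpectrum B`, `(g • w).asIdeal = g • 𝔭_w`).  HC_CM is proved only modulo the printed citations until rung 0 closes; nothing here is about HC.

THE MATHEMATICS ([NeukirchANT1999] Ch. I §9 (decomposition group; the conjugates `σ𝔓`), Ch. III §1 (1.6); [Shimura1998] §13.1 (the prime
decomposition of a type norm)).  For a finite set `Ψ ⊆ G` and a prime `w`, split the product `𝔞 := ∏_{g ∈ Ψ} (g • 𝔭_w)` according to whether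
`g • w = w`: `𝔞 = 𝔭_w^d · 𝔟` with `d = #{g ∈ Ψ | g • w = w}` and `𝔟 = ∏_{g ∈ Ψ, g • w ≠ w} 𝔭_{g • w}` COPRIME to `𝔭_w` (§1).  If `Ψ` CONTAINS THE
STABILISER of `w` (`g • w = w ⇒ g ∈ Ψ` — the «matching condition» of a CM type at a place) then `d = #Stab_G(w)`; if moreover `Ψ` is disjoint
from its translate `cΨ` by some `c ∈ G` (half of «`Ψ` is a CM type for the involution `c`»), then NO `g ∈ Ψ` moves `w` to `c • w` (else
`c⁻¹g ∈ Stab(w) ⊆ Ψ` and `c(c⁻¹g) = g ∈ Ψ`), so `𝔟` is also coprime to `𝔭_{c • w}` (§2).  §3: elementary divisibility bookkeeping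
(`𝔭^{n+1} ∤ 𝔭^n 𝔟` for `𝔟` coprime to `𝔭`; the product over all of `G` divides the product over `Ψ`).  FILE B
(`ComplexMultiplication/CMTypePrimeProductFrobeniusShape`) reads `∏_{g ∈ G} (g • 𝔭_w) = (N 𝔭_w)` for `F ∕ ℚ` Galois and assembles the six clauses of
`frob₀_twist`.

MAIN STATEMENTS.  §1 `prod_smul_asIdeal_eq_pow_mul`, `prod_filter_ne_sup_asIdeal_eq_top`; §2 `smul_ne_smul_of_mem`, `prod_filter_ne_sup_smul_asIdeal_eq_top`,
`card_filter_smul_eq_eq_card_univ_filter`; §3 `not_pow_succ_dvd_pow_mul_of_sup_eq_top`, `prod_univ_smul_asIdeal_le_prod`, `dvd_of_prod_univ_eq`.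

## References
* [NeukirchANT1999] J. Neukirch, *Algebraic Number Theory*, Grundlehren 322 (1999), Ch. I §9 (decomposition groups), Ch. III §1 (1.6).
* [Shimura1998] G. Shimura, *Abelian Varieties with Complex Multiplication and Modular Functions* (1998), §13.1 (prime decomposition of type norms).
-/

set_option autoImplicit false

open IsDedekindDomain
open scoped Pointwise

namespace Literature.NumberTheory.NumberFields

open Literature.NumberTheory.Automorphic

variable {B : Type*} [CommRing B] [IsDedekindDomain B] {G : Type*} [Group G] [MulSemiringAction G B]

/-! ### §1 Splitting the product at the fixed points -/

omit [IsDedekindDomain B] in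
/-- **`∏_{g ∈ Ψ} 𝔭_{g•w} = 𝔭_w^d · ∏_{g ∈ Ψ, g•w ≠ w} 𝔭_{g•w}`** with `d = #{g ∈ Ψ | g • w = w}`. [cite: NeukirchANT1999, Ch. I §9] -/
theorem prod_smul_asIdeal_eq_pow_mul [DecidableEq (HeightOneSpectrum B)] (Ψ : Finset G) (w : HeightOneSpectrum B) :
    ∏ g ∈ Ψ, (g • w).asIdeal =
      w.asIdeal ^ (Ψ.filter (fun g => g • w = w)).card * ∏ g ∈ Ψ.filter (fun g => g • w ≠ w), (g • w).asIdeal := by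
  rw [← Finset.prod_filter_mul_prod_filter_not Ψ (fun g => g • w = w)]
  congr 1
  rw [Finset.prod_congr rfl (fun g hg => by rw [(Finset.mem_filter.mp hg).2] : ∀ g ∈ Ψ.filter (fun g => g • w = w),
      (g • w).asIdeal = w.asIdeal), Finset.prod_const]

/-- **The moving part is coprime to `𝔭_w`**: `(∏_{g ∈ Ψ, g•w ≠ w} 𝔭_{g•w}) + 𝔭_w = (1)` (distinct non-zero primes of a Dedekind domain are
comaximal). [cite: NeukirchANT1999, Ch. I §9] -/
theorem prod_filter_ne_sup_asIdeal_eq_top [DecidableEq (HeightOneSpectrum B)] (Ψ : Finset G) (w : HeightOneSpectrum B) :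
    (∏ g ∈ Ψ.filter (fun g => g • w ≠ w), (g • w).asIdeal) ⊔ w.asIdeal = ⊤ := by
  rw [← Ideal.isCoprime_iff_sup_eq]
  refine IsCoprime.prod_left fun g hg => ?_
  rw [Ideal.isCoprime_iff_sup_eq]
  exact Ideal.IsMaximal.coprime_of_ne (g • w).isMaximal w.isMaximal
    (fun h => (Finset.mem_filter.mp hg).2 (HeightOneSpectrum.ext h))

/-! ### §2 The matching condition `Stab(w) ⊆ Ψ` and the half CM-type condition `Ψ ∩ cΨ = ∅` -/

omit [IsDedekindDomain B] in
/-- **No `g ∈ Ψ` moves `w` to `c • w`** when `Stab(w) ⊆ Ψ` and `Ψ ∩ cΨ = ∅`: from `g • w = c • w` we get `c⁻¹g ∈ Stab(w) ⊆ Ψ`, and then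
`c · (c⁻¹ g) = g ∉ Ψ`. [cite: Shimura1998, §13.1] -/
theorem smul_ne_smul_of_mem (Ψ : Finset G) (w : HeightOneSpectrum B) (c : G) (hD : ∀ g : G, g • w = w → g ∈ Ψ)
    (hc : ∀ g ∈ Ψ, c * g ∉ Ψ) {g : G} (hg : g ∈ Ψ) : g • w ≠ c • w := by
  intro h
  have h1 : (c⁻¹ * g) • w = w := by rw [mul_smul, h, inv_smul_smul]
  have h2 := hc _ (hD _ h1)
  rw [mul_inv_cancel_left] at h2
  exact h2 hg

/-- **The moving part is coprime to `𝔭_{c•w}`** under `Stab(w) ⊆ Ψ`, `Ψ ∩ cΨ = ∅`. [cite: Shimura1998, §13.1] -/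
theorem prod_filter_ne_sup_smul_asIdeal_eq_top [DecidableEq (HeightOneSpectrum B)] (Ψ : Finset G) (w : HeightOneSpectrum B) (c : G)
    (hD : ∀ g : G, g • w = w → g ∈ Ψ) (hc : ∀ g ∈ Ψ, c * g ∉ Ψ) :
    (∏ g ∈ Ψ.filter (fun g => g • w ≠ w), (g • w).asIdeal) ⊔ (c • w).asIdeal = ⊤ := by
  rw [← Ideal.isCoprime_iff_sup_eq]
  refine IsCoprime.prod_left fun g hg => ?_
  rw [Ideal.isCoprime_iff_sup_eq]
  exact Ideal.IsMaximal.coprime_of_ne (g • w).isMaximal (c • w).isMaximal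
    (fun h => smul_ne_smul_of_mem Ψ w c hD hc (Finset.mem_filter.mp hg).1 (HeightOneSpectrum.ext h))

omit [IsDedekindDomain B] in
/-- Under `Stab(w) ⊆ Ψ` the fixed part of `Ψ` IS the stabiliser: `#{g ∈ Ψ | g • w = w} = #{g ∈ G | g • w = w}`. [cite: NeukirchANT1999, Ch. I §9] -/
theorem card_filter_smul_eq_eq_card_univ_filter [Fintype G] [DecidableEq (HeightOneSpectrum B)] (Ψ : Finset G)
    (w : HeightOneSpectrum B) (hD : ∀ g : G, g • w = w → g ∈ Ψ) :
    (Ψ.filter (fun g => g • w = w)).card = (Finset.univ.filter (fun g : G => g • w = w)).card := by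
  congr 1
  ext g
  simp only [Finset.mem_filter, Finset.mem_univ, true_and]
  exact ⟨fun h => h.2, fun h => ⟨hD g h, h⟩⟩

/-! ### §3 Divisibility bookkeeping -/

/-- `𝔭^{n+1} ∤ 𝔭^n · 𝔟` when `𝔟 + 𝔭 = (1)` (cancel `𝔭^n` in the Dedekind monoid of ideals; `𝔭 ∣ 𝔟` would force `𝔟 ⊆ 𝔭`).
[cite: NeukirchANT1999, Ch. I §9] -/
theorem not_pow_succ_dvd_pow_mul_of_sup_eq_top (w : HeightOneSpectrum B) (n : ℕ) {𝔟 : Ideal B} (h𝔟 : 𝔟 ⊔ w.asIdeal = ⊤) :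
    ¬ w.asIdeal ^ (n + 1) ∣ w.asIdeal ^ n * 𝔟 := by
  intro h
  rw [pow_succ, mul_dvd_mul_iff_left (pow_ne_zero n w.ne_bot)] at h
  have hle : 𝔟 ≤ w.asIdeal := Ideal.le_of_dvd h
  have : w.asIdeal = ⊤ := by
    rw [← top_le_iff, ← h𝔟]
    exact sup_le hle le_rfl
  exact w.isPrime.ne_top this

omit [IsDedekindDomain B] in
/-- **The product over all of `G` divides the product over `Ψ`** (more factors, smaller ideal). [cite: NeukirchANT1999, Ch. III §1 (1.6)] -/
theorem prod_univ_smul_asIdeal_le_prod [Fintype G] [DecidableEq G] (Ψ : Finset G) (w : HeightOneSpectrum B) :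
    ∏ g : G, (g • w).asIdeal ≤ ∏ g ∈ Ψ, (g • w).asIdeal := by
  rw [← Finset.prod_sdiff (Finset.subset_univ Ψ)]
  exact Ideal.mul_le_left

/-- If `∏_{g ∈ G} 𝔭_{g•w} = 𝔫` (FILE B: `𝔫 = (N 𝔭_w)` for a Galois extension), then under `Stab(w) ⊆ Ψ`: `𝔭_w^d ∣ 𝔫`, `𝔭_w^{d+1} ∤ 𝔫` for
`d = #{g ∈ Ψ | g • w = w}`, and `𝔫 ≤ ∏_{g ∈ Ψ} 𝔭_{g•w}`. [cite: NeukirchANT1999, Ch. III §1 (1.6)] -/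
theorem dvd_of_prod_univ_eq [Fintype G] [DecidableEq G] [DecidableEq (HeightOneSpectrum B)] (Ψ : Finset G) (w : HeightOneSpectrum B)
    (hD : ∀ g : G, g • w = w → g ∈ Ψ) {𝔫 : Ideal B} (h𝔫 : ∏ g : G, (g • w).asIdeal = 𝔫) :
    w.asIdeal ^ (Ψ.filter (fun g => g • w = w)).card ∣ 𝔫 ∧
      ¬ w.asIdeal ^ ((Ψ.filter (fun g => g • w = w)).card + 1) ∣ 𝔫 ∧
      𝔫 ≤ ∏ g ∈ Ψ, (g • w).asIdeal := by
  have hG := prod_smul_asIdeal_eq_pow_mul (Finset.univ : Finset G) w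
  rw [h𝔫, ← card_filter_smul_eq_eq_card_univ_filter Ψ w hD] at hG
  refine ⟨⟨_, hG⟩, ?_, h𝔫 ▸ prod_univ_smul_asIdeal_le_prod Ψ w⟩
  rw [hG]
  exact not_pow_succ_dvd_pow_mul_of_sup_eq_top w _ (prod_filter_ne_sup_asIdeal_eq_top Finset.univ w)

end Literature.NumberTheory.NumberFields
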